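import Summits.QuantumFields.GaugeBoot.TiltedBoxTwoDimBlocks
import Summits.QuantumFields.GaugeBoot.SlabKernelAnnulus
import HarnessLib

/-!
# The annulus of the odd square tilted box in two dimensions: rungs, layer words, the twist as a conjugation (gauge-boot, L3 supplement: 2D slab gluing 5/6)

HONEST FRAMING (cell `pub-gaugeboot`, page 1 of every file): the venture produces certified bounds
on lattice expectations at stated coupling, gauge group, dimension and torus size; NOT a mass gap,
NOT a continuum limit, NOT a string tension; NOT Yang–Mills-summit-bearing (barriers
`FixedCouplingUltralocality`, `PerturbativeInvisibility`). Bookkeeping for the POSITIVE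
two-dimensional result `TiltedBoxOddAxisRPTwoDim.lean`; it discharges nothing else.

The data of `SlabKernel.integral_mul_annulus` (`SlabKernelAnnulus.lean`) for the slab of the odd
square box `ℤ^d/Γ(2P+1, 2P+1, L)` in two dimensions (`TiltedBoxTwoDimBlocks.lean`): rungs
`rung t = (y₀ + t e_j, i)`, lower word letters `aFn t U = U(y₀ + t e_j, j)` (layer `P`), upper word
letters `bFn t U = U(y₀ + t e_j + e_i, j)` (layer `P + 1`); they are `2M`-periodic (`M = 2P + 1`), the
rungs are distinct, the letters do not see the rungs. The TWIST read on the links: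
`aFn t (Θ_i U) = bFn (t + M) U` (`aFn_configReflect`), hence the upper word is a CONJUGATE of the
reflected lower word: `∏ bFn t U = c · (∏ aFn t (Θ_i U)) · c⁻¹` (`oprod_bFn_eq_conj`). Finally the slab
factor of the Boltzmann weight is the annulus product of plaquette weights:
`e^{-β ∑_{slab}(N - Re tr ρ(U_p))} = e^{-βN·2M} ∏_{t<2M} ω_β(a_t V_{t+1} b_t⁻¹ V_t⁻¹)` (`exp_slab_eq`).

References: A. A. Migdal, Sov. Phys. JETP 42 (1975) 413; J. Fröhlich, R. Israel, E. H. Lieb, B. Simon,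
J. Stat. Phys. 22 (1980) 297, §3.
-/

noncomputable section

open MeasureTheory Complex Function
open Literature.RepresentationTheory.CompactGroups

namespace Summit.QuantumFields.GaugeBoot

namespace TiltedRP

namespace TwoDim

variable {d : ℕ} {i j : Fin d} {L P N : ℕ} [NeZero L] [NeZero P]
variable {G : Type*} [Group G] [TopologicalSpace G] [IsTopologicalGroup G] [CompactSpace G]
  [MeasurableSpace G] [BorelSpace G] [SecondCountableTopology G]
variable (ρ : G →* Matrix (Fin N) (Fin N) ℂ)

/-! ## The annulus data of the odd box -/

section Annulus

variable [DecidableEq (TiltedSite d i j (2 * P + 1) (2 * P + 1) L)]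

/-- The rungs of the annulus: the `i`-links `(y₀ + t e_j, i)` of the layer `P`. -/
def rung (t : ℕ) : Link (TiltedSite d i j (2 * P + 1) (2 * P + 1) L) d := (cyc (oddLayerSite d i j L P) t, i)

/-- The lower frozen neighbours: the `j`-links `a_t(U) = U(y₀ + t e_j, j)` of the layer `P`. -/
def aFn (t : ℕ) (U : Config (TiltedSite d i j (2 * P + 1) (2 * P + 1) L) d G) : G :=
  U (cyc (oddLayerSite d i j L P) t, j)

/-- The upper frozen neighbours: the `j`-links `b_t(U) = U(y₀ + t e_j + e_i, j)` of the layer `P + 1`. -/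
def bFn (t : ℕ) (U : Config (TiltedSite d i j (2 * P + 1) (2 * P + 1) L) d G) : G :=
  U (cyc (oddLayerSite d i j L P) t + tiltedUnit d i j (2 * P + 1) (2 * P + 1) L i, j)

omit [NeZero L] [NeZero P] [TopologicalSpace G] [IsTopologicalGroup G] [CompactSpace G] [MeasurableSpace G]
  [BorelSpace G] [SecondCountableTopology G] [DecidableEq (TiltedSite d i j (2 * P + 1) (2 * P + 1) L)] in
/-- The rungs are `2M`-periodic. [folklore] -/
theorem rung_add_two_mul (hij : i ≠ j) (t : ℕ) :
    (rung (t + 2 * (2 * P + 1)) : Link (TiltedSite d i j (2 * P + 1) (2 * P + 1) L) d) = rung t := by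
  simp only [rung, cyc_add_two_mul hij]

omit [NeZero L] [NeZero P] [TopologicalSpace G] [IsTopologicalGroup G] [CompactSpace G] [MeasurableSpace G]
  [BorelSpace G] [SecondCountableTopology G] [DecidableEq (TiltedSite d i j (2 * P + 1) (2 * P + 1) L)] in
/-- The rungs `r 0, …, r (2M-1)` are distinct. [folklore] -/
theorem rung_inj (hij : i ≠ j) (s t : ℕ) (hs : s < 2 * (2 * P + 1)) (ht : t < 2 * (2 * P + 1))
    (h : (rung s : Link (TiltedSite d i j (2 * P + 1) (2 * P + 1) L) d) = rung t) : s = t :=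
  cyc_inj hij _ hs ht (congrArg Prod.fst h)

omit [NeZero L] [NeZero P] [Group G] [TopologicalSpace G] [IsTopologicalGroup G] [CompactSpace G]
  [MeasurableSpace G] [BorelSpace G] [SecondCountableTopology G] in
/-- The lower neighbours do not see the rungs. [folklore] -/
theorem aFn_update (hij : i ≠ j) (t s : ℕ) (U : Config (TiltedSite d i j (2 * P + 1) (2 * P + 1) L) d G) (z : G) :
    aFn t (update U (rung s) z) = aFn t U := by
  unfold aFn rung
  rw [update_of_ne]
  exact fun h => hij (congrArg Prod.snd h).symm

omit [NeZero L] [NeZero P] [Group G] [TopologicalSpace G] [IsTopologicalGroup G] [CompactSpace G]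
  [MeasurableSpace G] [BorelSpace G] [SecondCountableTopology G] in
/-- The upper neighbours do not see the rungs. [folklore] -/
theorem bFn_update (hij : i ≠ j) (t s : ℕ) (U : Config (TiltedSite d i j (2 * P + 1) (2 * P + 1) L) d G) (z : G) :
    bFn t (update U (rung s) z) = bFn t U := by
  unfold bFn rung
  rw [update_of_ne]
  exact fun h => hij (congrArg Prod.snd h).symm

omit [NeZero L] [NeZero P] [Group G] [TopologicalSpace G] [IsTopologicalGroup G] [CompactSpace G]
  [MeasurableSpace G] [BorelSpace G] [SecondCountableTopology G]
  [DecidableEq (TiltedSite d i j (2 * P + 1) (2 * P + 1) L)] in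
/-- The upper neighbours are `2M`-periodic. [folklore] -/
theorem bFn_add_two_mul (hij : i ≠ j) (t : ℕ) (U : Config (TiltedSite d i j (2 * P + 1) (2 * P + 1) L) d G) :
    bFn (t + 2 * (2 * P + 1)) U = bFn t U := by
  simp only [bFn, cyc_add_two_mul hij]

omit [NeZero L] [NeZero P] [TopologicalSpace G] [IsTopologicalGroup G] [CompactSpace G] [MeasurableSpace G]
  [BorelSpace G] [SecondCountableTopology G] [DecidableEq (TiltedSite d i j (2 * P + 1) (2 * P + 1) L)] in
/-- **The twist, read on the links**: `(Θ_i U)(y₀ + t e_j, j) = U(y₀ + (t + M) e_j + e_i, j)` —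
the reflected lower word is the upper word ROTATED by half a period. [folklore] -/
theorem aFn_configReflect (hij : i ≠ j) (t : ℕ) (U : Config (TiltedSite d i j (2 * P + 1) (2 * P + 1) L) d G) :
    aFn t (configReflect (tiltedUnit d i j (2 * P + 1) (2 * P + 1) L) i (tiltedAxisFlip d L (2 * P + 1) hij) U) =
      bFn (t + (2 * P + 1)) U := by
  unfold aFn bFn
  rw [configReflect_other _ i _ U _ (Ne.symm hij), tiltedAxisFlip_cyc hij]

omit [NeZero L] [NeZero P] [TopologicalSpace G] [IsTopologicalGroup G] [CompactSpace G] [MeasurableSpace G]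
  [BorelSpace G] [SecondCountableTopology G] [DecidableEq (TiltedSite d i j (2 * P + 1) (2 * P + 1) L)] in
/-- **The twist is a conjugation of the layer word**: `∏ b_t(U) = c · (∏ a_t(Θ U)) · c⁻¹` with
`c = b_0 ⋯ b_{M-1}`. [folklore] -/
theorem oprod_bFn_eq_conj (hij : i ≠ j) (U : Config (TiltedSite d i j (2 * P + 1) (2 * P + 1) L) d G) :
    SlabKernel.oprod bFn (2 * (2 * P + 1)) U =
      SlabKernel.oprod bFn (2 * P + 1) U *
        SlabKernel.oprod aFn (2 * (2 * P + 1))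
          (configReflect (tiltedUnit d i j (2 * P + 1) (2 * P + 1) L) i (tiltedAxisFlip d L (2 * P + 1) hij) U) *
        (SlabKernel.oprod bFn (2 * P + 1) U)⁻¹ := by
  have hΘ : SlabKernel.oprod aFn (2 * (2 * P + 1))
      (configReflect (tiltedUnit d i j (2 * P + 1) (2 * P + 1) L) i (tiltedAxisFlip d L (2 * P + 1) hij) U) =
      SlabKernel.oprod (fun t => bFn ((2 * P + 1) + t)) (2 * (2 * P + 1)) U := by
    unfold SlabKernel.oprod
    congr 1
    refine List.map_congr_left fun t _ => ?_
    rw [aFn_configReflect hij, add_comm]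
  rw [hΘ, show 2 * (2 * P + 1) = (2 * P + 1) + (2 * P + 1) from two_mul _,
    SlabKernel.oprod_add bFn (2 * P + 1) (2 * P + 1) U,
    SlabKernel.oprod_add (fun t => bFn ((2 * P + 1) + t)) (2 * P + 1) (2 * P + 1) U]
  have hper : SlabKernel.oprod (fun t => bFn ((2 * P + 1) + ((2 * P + 1) + t))) (2 * P + 1) U =
      SlabKernel.oprod bFn (2 * P + 1) U := by
    unfold SlabKernel.oprod
    congr 1
    refine List.map_congr_left fun t _ => ?_
    show bFn ((2 * P + 1) + ((2 * P + 1) + t)) U = bFn t U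
    rw [← add_assoc, ← two_mul, add_comm, bFn_add_two_mul hij]
  rw [hper]
  group

/-! ## The slab product as an annulus of plaquette weights -/

omit [NeZero L] [NeZero P] [MeasurableSpace G] [BorelSpace G] [SecondCountableTopology G]
  [DecidableEq (TiltedSite d i j (2 * P + 1) (2 * P + 1) L)] in
/-- The plaquette weight of the `t`-th annulus plaquette is `ω_β(a_t V_{t+1} b_t⁻¹ V_t⁻¹)`. [folklore] -/
theorem exp_plaqObs_annulus (hij : i ≠ j) (hρ : Continuous ρ) (β : ℝ) (t : ℕ)
    (U : Config (TiltedSite d i j (2 * P + 1) (2 * P + 1) L) d G) :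
    (Real.exp (β * plaqObs ρ (tiltedUnit d i j (2 * P + 1) (2 * P + 1) L) (cyc (oddLayerSite d i j L P) t, dp hij) U)
        : ℂ) = SlabKernel.plaqWt (SlabKernel.wilsonWt ρ β) rung aFn bFn t U := by
  unfold SlabKernel.plaqWt SlabKernel.wilsonWt plaqObs aFn bFn rung
  congr 3
  unfold dp mkDirPair
  by_cases h : i < j
  · rw [dif_pos h]
    simp only [holonomy, cyc_succ]
    rw [← CompactGroup.re_trace_map_inv ρ hρ]
    congr 3
    group
  · rw [dif_neg h]
    simp only [holonomy, cyc_succ]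

omit [NeZero P] [MeasurableSpace G] [BorelSpace G] [SecondCountableTopology G] in
open scoped Classical in
/-- **The slab factor**: `e^{-β ∑_{slab} (N - Re tr ρ(U_p))} = e^{-βN·2M} ∏_{t<2M} plaqWt_t(U)`. [folklore] -/
theorem exp_slab_eq (hij : i ≠ j) (hd : ∀ k : Fin d, k = i ∨ k = j) (hρ : Continuous ρ) (β : ℝ)
    (U : Config (TiltedSite d i j (2 * P + 1) (2 * P + 1) L) d G) :
    (Real.exp (-β * ∑ p ∈ Finset.univ.filter (IsSlabPlaq (P := P)),
        ((N : ℝ) - plaqObs ρ (tiltedUnit d i j (2 * P + 1) (2 * P + 1) L) p U)) : ℂ) =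
      (Real.exp (-β * N * (2 * (2 * P + 1))) : ℂ) *
        ∏ t ∈ Finset.range (2 * (2 * P + 1)), SlabKernel.plaqWt (SlabKernel.wilsonWt ρ β) rung aFn bFn t U := by
  rw [filter_isSlabPlaq_eq_image hij hd, Finset.sum_image (annulus_injOn hij)]
  simp_rw [← exp_plaqObs_annulus ρ hij hρ β]
  rw [← Complex.ofReal_prod, ← Complex.ofReal_mul, ← Real.exp_sum, ← Real.exp_add]
  congr 1
  rw [Finset.sum_sub_distrib, Finset.sum_const, Finset.card_range, nsmul_eq_mul, ← Finset.mul_sum]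
  push_cast
  ring

end Annulus

end TwoDim

end TiltedRP

end Summit.QuantumFields.GaugeBoot

end
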